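import Mathlib
import Summits.NavierStokesRegularity.NavierStokesRegularity.Theorems.WakeRatchetTailRatchetPostFiringLeadingEdge
import HarnessLib

/-!
# `WakeRatchet.TailRatchet` (stmt-NavierStokesRegularity-21808), door D4′ — an unconditional SPEED LIMIT of the
# firing front: two consecutive first-firing gaps take log-time `≥ c(1 − Λc)/(ΛB²)`

Def-free support lemmas (MODEL lattice ODEs: the scalar dyadic member of Tao 2016 §1.2 / §4 in the renormalised
variables of §6.4; nothing here concerns the Navier–Stokes equations; stmt-21808 is neither proved nor refuted here
and no stub of skeleton d00b85951d7c is closed).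

SETTING as in `WakeRatchetTailRatchetPostFiringLeadingEdge`: half-line solution `W` of the renormalised lattice,
`0 ≤ W ≤ B` on `σ ≥ A`, quiet start, lower rate at level `c` (`Λc ≤ 1`), first-firing clock `s` (monotone).

* `firstFiring_two_step_gap` — `s (N+2) ≥ s N + c(1 − Λc)/(ΛB²)` for every `N`: by the leading edge
  (`leadingEdge_Icc`) shell `N+2` is `≤ Λc²` at `s_N`, and a row fed by `W_{N+1} ≤ B` climbs from `Λc²` to `c` in
  log-time at least `c(1−Λc)/(ΛB²)` (`exp_mul_le_of_feed_sq_le` with the crude feed bound `B²`, and `1 − e^{−x} ≤ x`);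
* `firstFiring_ge_linear` — hence `s (N + 2m) ≥ s N + m·c(1−Λc)/(ΛB²)`: the front advances at most
  `2ΛB²/(c(1−Λc))` shells per unit log-time, unconditionally (no (D′)).

With the type-I bound `B = 2Λ²/(Λ−1)²` of the one-shell dyadic blow-up this speed limit is `≍ ε₀⁴` shells⁻¹, far
from the true speed `1/T ≈ 1.4/log Λ` (census CENSUS-21808-leafhand4-g17.md); it is recorded as the unconditional
companion of the energy-line bound `s_N ≤ N log Λ + C` on the other side.

HONEST FRAMING: elementary real analysis; (D)/(QT)/(G) are NOT proved here; rung 0.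
-/

noncomputable section

set_option linter.dupNamespace false

namespace Summit.NavierStokesRegularity.NavierStokesRegularity.Theorems

namespace WakeRatchetDyadicPostFiring

open Set Filter Topology
open WakeRatchetFiringClock

variable {Λ : ℝ} {W : ℤ → ℝ → ℝ} {A₀ A B c : ℝ}

/-- **Two-step gap of the firing clock (unconditional).**  For every `N`:
`s (N+2) ≥ s N + c(1 − Λc)/(ΛB²)`.
[cite: Tao2016AveragedNS, §1.2, §4 Lemma 4.1 (4.8), §6.4; elementary] -/
theorem firstFiring_two_step_gap (hΛ : 0 < Λ) (hA : A₀ < A) (hc : 0 < c) (hΛc : Λ * c ≤ 1)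
    (hlaw : ∀ (n : ℤ) (σ : ℝ), A₀ < σ → HasDerivAt (W n)
      (-(W n σ) + Λ * W (n - 1) σ ^ 2 - Λ⁻¹ * W n σ * W (n + 1) σ) σ)
    (hnn : ∀ (n : ℤ) (σ : ℝ), A ≤ σ → 0 ≤ W n σ) (hB : ∀ (n : ℤ) (σ : ℝ), A ≤ σ → W n σ ≤ B)
    (hneg : ∀ n : ℤ, n < 0 → ∀ σ : ℝ, A ≤ σ → W n σ = 0) (hstart : ∀ n : ℤ, 0 < n → W n A = 0)
    (hrate : ∀ σ : ℝ, A ≤ σ → ∃ n : ℤ, c ≤ W n σ)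
    {s : ℕ → ℝ} (hs1 : ∀ n : ℕ, A ≤ s n) (hs2 : ∀ n : ℕ, c ≤ W n (s n))
    (hs3 : ∀ (n : ℕ) (σ : ℝ), A ≤ σ → c ≤ W (n : ℤ) σ → s n ≤ σ) (hmono : Monotone s) (N : ℕ) :
    s N + c * (1 - Λ * c) / (Λ * B ^ 2) ≤ s (N + 2) := by
  set a : ℝ := s N with ha
  set b : ℝ := s (N + 2) with hb
  have haA : A ≤ a := hs1 N
  have hab : a ≤ b := hmono (by omega)
  have hB0 : 0 < B := hc.trans_le ((hs2 N).trans (hB _ _ haA))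
  have hΛB : 0 < Λ * B ^ 2 := by positivity
  -- shell `N+2` at `s N` is `≤ Λc²` (leading edge, `i = 1`)
  have hinit : W ((N : ℤ) + 1 + (1 : ℕ)) a ≤ Λ⁻¹ * (Λ * c) ^ (2 ^ 1) :=
    (leadingEdge_Icc hΛ hA hc hΛc hlaw hnn hneg hstart hrate hs1 hs3 hmono N).2 1 le_rfl a
      ⟨le_rfl, hmono (Nat.le_succ N)⟩
  have e2 : (N : ℤ) + 1 + ((1 : ℕ) : ℤ) = ((N + 2 : ℕ) : ℤ) := by push_cast; ring
  have hlev : Λ⁻¹ * (Λ * c) ^ (2 ^ 1) = Λ * c ^ 2 := by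
    rw [pow_one]; field_simp
  rw [e2, hlev] at hinit
  -- the row of shell `N+2` on `[a,b]`, fed by `W_{N+1} ≤ B`
  have hv : ∀ σ ∈ Ico a b, HasDerivAt (W ((N + 2 : ℕ) : ℤ))
      (-(W ((N + 2 : ℕ) : ℤ) σ) + Λ * W (((N + 2 : ℕ) : ℤ) - 1) σ ^ 2
        - Λ⁻¹ * W ((N + 2 : ℕ) : ℤ) σ * W (((N + 2 : ℕ) : ℤ) + 1) σ) σ :=
    fun σ hσ => hlaw _ σ (hA.trans_le (haA.trans hσ.1))
  have hvc : ContinuousOn (W ((N + 2 : ℕ) : ℤ)) (Icc a b) := continuousOn_Icc hlaw _ (hA.trans_le haA)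
  have hv0 : ∀ σ ∈ Icc a b, 0 ≤ W ((N + 2 : ℕ) : ℤ) σ := fun σ hσ => hnn _ σ (haA.trans hσ.1)
  have hz0 : ∀ σ ∈ Icc a b, 0 ≤ W (((N + 2 : ℕ) : ℤ) + 1) σ := fun σ hσ => hnn _ σ (haA.trans hσ.1)
  have hu : ∀ σ ∈ Ico a b, W (((N + 2 : ℕ) : ℤ) - 1) σ ^ 2 ≤ B ^ 2 := fun σ hσ =>
    pow_le_pow_left₀ (hnn _ σ (haA.trans hσ.1)) (hB _ σ (haA.trans hσ.1)) 2
  have hkey := exp_mul_le_of_feed_sq_le hΛ hv hvc hv0 hz0 hu b (right_mem_Icc.2 hab)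
  -- at `b = s (N+2)` the shell is at level `≥ c`
  have hfire : c ≤ W ((N + 2 : ℕ) : ℤ) b := hs2 (N + 2)
  have heb : 0 < Real.exp b := Real.exp_pos b
  have hea : 0 < Real.exp a := Real.exp_pos a
  -- `c e^b ≤ e^a Λc² + ΛB²(e^b − e^a)`, i.e. `c − Λc² ≤ (ΛB² − Λc²)(1 − e^{a−b}) ≤ ΛB² (1 − e^{−(b−a)})`
  have hq : Real.exp a = Real.exp (-(b - a)) * Real.exp b := by
    rw [← Real.exp_add]; congr 1; ring
  have hq0 : 0 ≤ Real.exp (-(b - a)) := (Real.exp_pos _).le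
  have hq1 : Real.exp (-(b - a)) ≤ 1 := by
    rw [Real.exp_le_one_iff]; linarith
  have h1 : c * Real.exp b ≤ Real.exp a * (Λ * c ^ 2) + Λ * B ^ 2 * (Real.exp b - Real.exp a) := by
    calc c * Real.exp b ≤ Real.exp b * W ((N + 2 : ℕ) : ℤ) b := by nlinarith
      _ ≤ Real.exp a * W ((N + 2 : ℕ) : ℤ) a + Λ * B ^ 2 * (Real.exp b - Real.exp a) := hkey
      _ ≤ Real.exp a * (Λ * c ^ 2) + Λ * B ^ 2 * (Real.exp b - Real.exp a) := by
          gcongr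
  -- divide by `e^b`
  have h2 : c ≤ Real.exp (-(b - a)) * (Λ * c ^ 2) + Λ * B ^ 2 * (1 - Real.exp (-(b - a))) := by
    rw [hq] at h1
    have : c * Real.exp b ≤ Real.exp b * (Real.exp (-(b - a)) * (Λ * c ^ 2)
        + Λ * B ^ 2 * (1 - Real.exp (-(b - a)))) := by
      calc c * Real.exp b ≤ Real.exp (-(b - a)) * Real.exp b * (Λ * c ^ 2)
            + Λ * B ^ 2 * (Real.exp b - Real.exp (-(b - a)) * Real.exp b) := h1
        _ = Real.exp b * (Real.exp (-(b - a)) * (Λ * c ^ 2)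
            + Λ * B ^ 2 * (1 - Real.exp (-(b - a)))) := by ring
    rw [mul_comm] at this
    exact le_of_mul_le_mul_left this heb
  have hc2 : 0 ≤ Λ * c ^ 2 := by positivity
  have h3 : c * (1 - Λ * c) ≤ Λ * B ^ 2 * (1 - Real.exp (-(b - a))) := by
    have : Real.exp (-(b - a)) * (Λ * c ^ 2) ≤ Λ * c ^ 2 := by nlinarith
    nlinarith
  have hx : 1 - Real.exp (-(b - a)) ≤ b - a := by
    have := Real.add_one_le_exp (-(b - a)); linarith
  have h4 : c * (1 - Λ * c) ≤ Λ * B ^ 2 * (b - a) :=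
    h3.trans (mul_le_mul_of_nonneg_left hx hΛB.le)
  have h5 : c * (1 - Λ * c) / (Λ * B ^ 2) ≤ b - a := by
    rw [div_le_iff₀ hΛB]; linarith
  linarith

/-- **Linear lower bound of the firing clock (unconditional speed limit of the front).**  For all `N, m`:
`s (N + 2m) ≥ s N + m · c(1 − Λc)/(ΛB²)`.
[cite: Tao2016AveragedNS, §1.2, §4 Lemma 4.1 (4.8), §6.4; elementary] -/
theorem firstFiring_ge_linear (hΛ : 0 < Λ) (hA : A₀ < A) (hc : 0 < c) (hΛc : Λ * c ≤ 1)
    (hlaw : ∀ (n : ℤ) (σ : ℝ), A₀ < σ → HasDerivAt (W n)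
      (-(W n σ) + Λ * W (n - 1) σ ^ 2 - Λ⁻¹ * W n σ * W (n + 1) σ) σ)
    (hnn : ∀ (n : ℤ) (σ : ℝ), A ≤ σ → 0 ≤ W n σ) (hB : ∀ (n : ℤ) (σ : ℝ), A ≤ σ → W n σ ≤ B)
    (hneg : ∀ n : ℤ, n < 0 → ∀ σ : ℝ, A ≤ σ → W n σ = 0) (hstart : ∀ n : ℤ, 0 < n → W n A = 0)
    (hrate : ∀ σ : ℝ, A ≤ σ → ∃ n : ℤ, c ≤ W n σ)
    {s : ℕ → ℝ} (hs1 : ∀ n : ℕ, A ≤ s n) (hs2 : ∀ n : ℕ, c ≤ W n (s n))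
    (hs3 : ∀ (n : ℕ) (σ : ℝ), A ≤ σ → c ≤ W (n : ℤ) σ → s n ≤ σ) (hmono : Monotone s) (N m : ℕ) :
    s N + m * (c * (1 - Λ * c) / (Λ * B ^ 2)) ≤ s (N + 2 * m) := by
  induction m with
  | zero => simp
  | succ m ih =>
    have h := firstFiring_two_step_gap hΛ hA hc hΛc hlaw hnn hB hneg hstart hrate hs1 hs2 hs3 hmono
      (N + 2 * m)
    rw [show N + 2 * (m + 1) = N + 2 * m + 2 by ring]
    push_cast
    linarith

end WakeRatchetDyadicPostFiring

end Summit.NavierStokesRegularity.NavierStokesRegularity.Theorems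

end
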